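import Mathlib
import HarnessLib
import Summits.HubbardSuperconductivity.HubbardSuperconductivity.Theorems.KLProgrammeKLRegimeEnginePairTransferOutClassHoutG14
import Summits.HubbardSuperconductivity.HubbardSuperconductivity.Theorems.KLProgrammeKLRegimeEnginePairTransferOutClassBarsShareSplitCells

/-!
# Route `KLProgramme` — ENGINE stmt-HubbardSuperconductivity-20437 `KLRegimeEngineV17F2`, stub (c) value lane: `hout` AT `klEngGeo14` LITERALLY with the member PH kernel data
# RE-KEYED ON THE CELL SPLIT / angular-cell Lipschitz data (brick (L4)-6 of cure (A″) route 3′ of located «(c)-OUT-COOPER-ANTIPODE»; cell gate-hubbard-kl, seat hubbard-kl-k3c2-p2 g26)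

Twins of `outClass_hout_klEngGeo14_of_shares(_of_raw)_split3` on `outClass_sameFrame_le_bars_share_cells` (…OutClassBarsShareSplitCells): the `F₁` pins carry a global
`K_g` and angular-cell data (arcs/serving sets around the Fermi curve of the flow frame `Kₙ = klFlowFrameU … n`), the window part is a finite family; shares as the cells
closer (`hShareRL` absorbs `2·(3/π)·DEF⋆`, `hShareLat` at `K_g`, `hShareEps` summed over the family); steps (iii) un-smearing and the frame shift untouched.
* **`outClass_hout_klEngGeo14_of_shares_cells`**, **`outClass_hout_klEngGeo14_of_shares_of_raw_cells`**.
Composition only; nothing about the model's sizes is asserted; nothing asserts (E2″-F), (c), K3 or superconductivity.  0 kit · 0 lit.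
-/

noncomputable section

namespace Summit.HubbardSuperconductivity.HubbardSuperconductivity.Theorems.KLRegimeSplit

set_option linter.dupNamespace false -- summit = problem name (single-conjunct summit), D-0017

open Real Set Finset Complex Matrix Literature.MathematicalPhysics.QuantumLattice GrassmannAlgebra
open Literature.Probability.LatticeModels hiding torusSupNorm
open Literature.MathematicalPhysics.QuantumLattice.BandSectorCounting
open Summit.HubbardSuperconductivity.HubbardSuperconductivity.Theorems.KLProgrammeLegKernels
open Summit.HubbardSuperconductivity.HubbardSuperconductivity.Theorems.KLRegimeWick
open Summit.HubbardSuperconductivity.HubbardSuperconductivity.Theorems.TwoPointAssembly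
open Summit.HubbardSuperconductivity.HubbardSuperconductivity.Theorems.EngineV8
open Summit.HubbardSuperconductivity.HubbardSuperconductivity.Theorems.DispersionFlow
open Summit.HubbardSuperconductivity.HubbardSuperconductivity.Theorems.PerturbedFermiCurve

section Model

variable (L M : ℕ) [NeZero L] [NeZero M] (β U μ : ℝ) {a' b' : ℝ} (B : BandBounds a' b') {R : RenConsts} {N : ℕ} {Af : ℝ}

set_option maxHeartbeats 2400000 in -- ~90 literal binders through three doors; plumbing + linear arithmetic only
/-- **`hout` AT `klEngGeo14` WITH THE CLASS-#5 BAR IN SHARE FORM AND AN ABSTRACT EREM HOST** (AMENDMENT 25 «(X).3-KLTS-CAP + FLAT-CUBIC» shape): the binder list of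
`outClass_hout_klEngGeo13` (…OutClassHoutG13) VERBATIM except `hTb : Tb ≤ 2⁻¹⁵(KlamU)²(G14.phGain ρd + G14.phGain ρx) + E₂ + 2⁻⁵·thermalBar G14 (n+1)` (the shape delivered by
`transferBarRelIdx(3)_le_slots_klEngGeo14_of_cap` for ANY `0 ≤ r ≤ 2²⁰(1+klTS)`, flat cubic inside `E₂`) and `hE : 2s·eremBar G11 … n + E₂ ≤ Ē` (any host `Ē`:
`eremBar` via `hout_hE_cap_of_U`, `eremBar + 2³⁶(1+klTS)c₃(Klam|U|)³` via `hout_hE_cap_flat_of_U`); conclusion = the (E2″-F)ₙ₊₁ summand at `(klEngGeo14, Ē)`. -/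
theorem outClass_hout_klEngGeo14_of_shares_cells (hR : R.WF2) (hU : 0 < U) (hUu : U ≤ klTSU R) (hμC : μ ∈ klWindowC)
    (hβ : klBetaMin ≤ β) (hβL : β ≤ L) {n : ℕ} (hn : n ≤ nScales β) (hK : FrameOK R U N μ (klFlowFrameU L M β U μ n)) (hGL : 8 * (4 + 8 / 3 * R.Gfr 1 * U ^ 2) * β ≤ L) (hGU : 8 / 3 * R.Gfr 1 * U ^ 2 ≤ 1)
    (hAb : ∀ p : Momentum, ∀ j ≤ 2, ‖iteratedFDeriv ℝ j (frameShift (klFlowFrameU L M β U μ n)) p‖ ≤ Af) (hA : 4 * Af < B.Dtmin) (hA20 : 4 * Af ≤ 1 / 20) (hμ : μ ≤ -0.15)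
    (hlo : a' < μ - 4 * klScale klE0 (n + 1) - 4 * Af) (hhi : μ + 4 * klScale klE0 (n + 1) + 4 * Af < b')
    (hM : β * (4 * klScale klE0 (n + 1)) / (2 * Real.pi) + 1 ≤ M)
    (A A' : ℕ → TorusSite 2 L → ℝ → Matrix (TorusSite 2 L) (TorusSite 2 L) ℂ) (b' : ℕ → TorusSite 2 L → ℝ → TorusSite 2 L → ℂ)
    (hAdef : A = fun j Qm t => Matrix.of fun k k' : TorusSite 2 L => if k ∈ klBall L μ 0 ∧ k' ∈ klBall L μ 0 then
      vertexFn L M β (gaussConv ℂ (softCovOf L M β μ (klFlowFrameU L M β U μ n) (softSymbolCompl L M β μ (klFlowFrameU L M β U μ n) (n + 1) j) + hubbardCovAboveCT L M β μ 0 (klFlowFrameU L M β U μ n) (klScale klE0 (n + 1)) - hubbardCovAboveCT L M β μ 0 (klFlowFrameU L M β U μ n)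
              (klScale klE0 n + t * (klScale klE0 (n + 1) - klScale klE0 n))) (hubbardEffectiveActionCT L M β U μ 0 (klFlowFrameU L M β U μ n) (klScale klE0 n + t * (klScale klE0 (n + 1) - klScale klE0 n)))) 4
              ![(((omega0 M, k'), 0), 0), ((((omega0 M).rev, Qm - k'), 1), 0), ((((omega0 M).rev, Qm - k), 1), 1), (((omega0 M, k), 0), 1)]
      else 0)
    (hA'def : A' = fun j Qm t => Matrix.of fun k k' : TorusSite 2 L => if k ∈ klBall L μ 0 ∧ k' ∈ klBall L μ 0 then
      (klScale klE0 (n + 1) - klScale klE0 n) • -((2 : ℂ)⁻¹ * vertexFn L M β (gaussConv ℂ (softCovOf L M β μ (klFlowFrameU L M β U μ n) (softSymbolCompl L M β μ (klFlowFrameU L M β U μ n) (n + 1) j) + hubbardCovAboveCT L M β μ 0 (klFlowFrameU L M β U μ n)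
              (klScale klE0 (n + 1)) - hubbardCovAboveCT L M β μ 0 (klFlowFrameU L M β U μ n) (klScale klE0 n + t * (klScale klE0 (n + 1) - klScale klE0 n))) (grassmannDerivPairing ℂ (Matrix.of fun X Y :
              HubbardFieldIdx L M => deriv (fun Λ'' : ℝ => hubbardCovAboveCT L M β μ 0 (klFlowFrameU L M β U μ n) Λ'' X Y) (klScale klE0 n + t * (klScale klE0 (n + 1) - klScale klE0 n)))
              (hubbardEffectiveActionCT L M β U μ 0 (klFlowFrameU L M β U μ n) (klScale klE0 n + t * (klScale klE0 (n + 1) - klScale klE0 n))) (hubbardEffectiveActionCT L M β U μ 0 (klFlowFrameU L M β U μ n) (klScale klE0 n + t *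
              (klScale klE0 (n + 1) - klScale klE0 n))))) 4 ![(((omega0 M, k'), 0), 0), ((((omega0 M).rev, Qm - k'), 1), 0), ((((omega0 M).rev, Qm - k), 1), 1), (((omega0 M, k), 0),
              1)])
      else 0)
    (hb'def : b' = fun (j : ℕ) (Qm : TorusSite 2 L) (t : ℝ) (p : TorusSite 2 L) => (((klScale klE0 (n + 1) - klScale klE0 n) *
        (klBubbleMass L M β μ (klFlowFrameU L M β U μ n) (fun k => deriv (fun Λ' => hubbardCutoffWeightCT L M β μ (klFlowFrameU L M β U μ n) Λ' k) (klScale klE0 n + t * (klScale klE0 (n + 1) - klScale klE0 n))) (fun k =>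
                (softSymbolCompl L M β μ (klFlowFrameU L M β U μ n) (n + 1) j) k + (hubbardCutoffWeightCT L M β μ (klFlowFrameU L M β U μ n) (klScale klE0 (n + 1)) k - hubbardCutoffWeightCT L M β μ (klFlowFrameU L M β U μ n) (klScale klE0 n + t * (klScale
                klE0 (n + 1) - klScale klE0 n)) k)) Qm p +
          klBubbleMass L M β μ (klFlowFrameU L M β U μ n) (fun k => (softSymbolCompl L M β μ (klFlowFrameU L M β U μ n) (n + 1) j) k + (hubbardCutoffWeightCT L M β μ (klFlowFrameU L M β U μ n) (klScale klE0 (n + 1)) k - hubbardCutoffWeightCT L M β μ (klFlowFrameU L M β U μ n)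
                  (klScale klE0 n + t * (klScale klE0 (n + 1) - klScale klE0 n)) k)) (fun k => deriv (fun Λ' => hubbardCutoffWeightCT L M β μ (klFlowFrameU L M β U μ n) Λ' k) (klScale klE0 n + t * (klScale
                  klE0 (n + 1) - klScale klE0 n))) Qm p) : ℝ) : ℂ))
    (V : ℕ → ℝ → (Fin 4 → HubbardFieldIdx L M) → ℂ) (hV : V = fun j t X => vertexFn L M β (gaussConv ℂ (softCovOf L M β μ (klFlowFrameU L M β U μ n) (softSymbolCompl L M β μ (klFlowFrameU L M β U μ n) (n + 1) j) + hubbardCovAboveCT L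
            M β μ 0 (klFlowFrameU L M β U μ n) (klScale klE0 (n + 1)) - hubbardCovAboveCT L M β μ 0 (klFlowFrameU L M β U μ n) (klScale klE0 n + t * (klScale klE0 (n + 1) - klScale klE0 n))) (hubbardEffectiveActionCT L M β U μ 0 (klFlowFrameU L M β U μ n)
            (klScale klE0 n + t * (klScale klE0 (n + 1) - klScale klE0 n)))) 4 X)
    (V6 : ℕ → ℝ → (Fin 6 → HubbardFieldIdx L M) → ℂ) (hV6 : V6 = fun j t X => vertexFn L M β (gaussConv ℂ (softCovOf L M β μ (klFlowFrameU L M β U μ n) (softSymbolCompl L M β μ (klFlowFrameU L M β U μ n) (n + 1) j) + hubbardCovAboveCT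
            L M β μ 0 (klFlowFrameU L M β U μ n) (klScale klE0 (n + 1)) - hubbardCovAboveCT L M β μ 0 (klFlowFrameU L M β U μ n) (klScale klE0 n + t * (klScale klE0 (n + 1) - klScale klE0 n))) (hubbardEffectiveActionCT L M β U μ 0 (klFlowFrameU L M β U μ n)
            (klScale klE0 n + t * (klScale klE0 (n + 1) - klScale klE0 n)))) 6 X)
    (Sg : ℕ → ℝ → FreqMomentum L M → Fin 2 → ℂ) (hSg : Sg = fun j t p σ => selfEnergy L M β (gaussConv ℂ (softCovOf L M β μ (klFlowFrameU L M β U μ n) (softSymbolCompl L M β μ (klFlowFrameU L M β U μ n) (n + 1) j) + hubbardCovAboveCT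
            L M β μ 0 (klFlowFrameU L M β U μ n) (klScale klE0 (n + 1)) - hubbardCovAboveCT L M β μ 0 (klFlowFrameU L M β U μ n) (klScale klE0 n + t * (klScale klE0 (n + 1) - klScale klE0 n))) (hubbardEffectiveActionCT L M β U μ 0 (klFlowFrameU L M β U μ n)
            (klScale klE0 n + t * (klScale klE0 (n + 1) - klScale klE0 n)))) p σ)
    (Hd : ℕ → ℝ → (Fin 4 → HubbardFieldIdx L M) → ℂ) (hHd : Hd = fun j t X => vertexFn L M β (dblFold ℂ (grassmannLaplacian ℂ (crossCov ℂ (Matrix.of fun X Y : HubbardFieldIdx L M =>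
            deriv (fun Λ' : ℝ => hubbardCovAboveCT L M β μ 0 (klFlowFrameU L M β U μ n) Λ' X Y) (klScale klE0 n + t * (klScale klE0 (n + 1) - klScale klE0 n)))) ((gaussConv ℂ (crossCov ℂ (softCovOf L M β μ (klFlowFrameU L M β U μ n)
            (softSymbolCompl L M β μ (klFlowFrameU L M β U μ n) (n + 1) j) + hubbardCovAboveCT L M β μ 0 (klFlowFrameU L M β U μ n) (klScale klE0 (n + 1)) - hubbardCovAboveCT L M β μ 0 (klFlowFrameU L M β U μ n) (klScale klE0 n + t * (klScale klE0 (n + 1) -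
            klScale klE0 n)))) - grassmannLaplacian ℂ (crossCov ℂ (softCovOf L M β μ (klFlowFrameU L M β U μ n) (softSymbolCompl L M β μ (klFlowFrameU L M β U μ n) (n + 1) j) + hubbardCovAboveCT L M β μ 0 (klFlowFrameU L M β U μ n) (klScale klE0 (n + 1)) -
            hubbardCovAboveCT L M β μ 0 (klFlowFrameU L M β U μ n) (klScale klE0 n + t * (klScale klE0 (n + 1) - klScale klE0 n))))) (dblCopy ℂ 0 (gaussConv ℂ (softCovOf L M β μ (klFlowFrameU L M β U μ n) (softSymbolCompl L M β μ (klFlowFrameU L M β U μ n) (n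
            + 1) j) + hubbardCovAboveCT L M β μ 0 (klFlowFrameU L M β U μ n) (klScale klE0 (n + 1)) - hubbardCovAboveCT L M β μ 0 (klFlowFrameU L M β U μ n) (klScale klE0 n + t * (klScale klE0 (n + 1) - klScale klE0 n)))
            (hubbardEffectiveActionCT L M β U μ 0 (klFlowFrameU L M β U μ n) (klScale klE0 n + t * (klScale klE0 (n + 1) - klScale klE0 n)))) * dblCopy ℂ 1 (gaussConv ℂ (softCovOf L M β μ (klFlowFrameU L M β U μ n) (softSymbolCompl L
            M β μ (klFlowFrameU L M β U μ n) (n + 1) j) + hubbardCovAboveCT L M β μ 0 (klFlowFrameU L M β U μ n) (klScale klE0 (n + 1)) - hubbardCovAboveCT L M β μ 0 (klFlowFrameU L M β U μ n) (klScale klE0 n + t * (klScale klE0 (n + 1) - klScale klE0 n)))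
            (hubbardEffectiveActionCT L M β U μ 0 (klFlowFrameU L M β U μ n) (klScale klE0 n + t * (klScale klE0 (n + 1) - klScale klE0 n)))))))) 4 X)
    (Φ : ℕ → ℝ → FreqMomentum L M → ℝ) (hΦ : Φ = fun j t k => (softSymbolCompl L M β μ (klFlowFrameU L M β U μ n) (n + 1) j) k + (hubbardCutoffWeightCT L M β μ (klFlowFrameU L M β U μ n) (klScale klE0 (n + 1)) k -
            hubbardCutoffWeightCT L M β μ (klFlowFrameU L M β U μ n) (klScale klE0 n + t * (klScale klE0 (n + 1) - klScale klE0 n)) k))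
    (Wd : ℝ → FreqMomentum L M → ℝ) (hWd : Wd = fun t k => deriv (fun Λ' : ℝ => hubbardCutoffWeightCT L M β μ (klFlowFrameU L M β U μ n) Λ' k) (klScale klE0 n + t * (klScale klE0 (n + 1) - klScale klE0 n)))
    (Br : ℕ → TorusSite 2 L → ℝ → TorusSite 2 L × MatsubaraIdx M → ℂ) (hBr : Br = fun j Qm t z => -(((((β * (L : ℝ) ^ 2 : ℝ) : ℂ)))⁻¹ * propCT L M β μ (klFlowFrameU L M β U μ n) (z.2, z.1) * propCT L M β μ (klFlowFrameU L M β U μ n)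
            (z.2.rev, Qm - z.1)) *
      ((((klScale klE0 (n + 1) - klScale klE0 n) * (-Wd t (z.2, z.1) * Φ j t (z.2.rev, Qm - z.1) - Φ j t (z.2, z.1) * Wd t (z.2.rev, Qm - z.1))) : ℝ) : ℂ))
    (j : ℕ) (hj : n + 1 ≤ j) {Qm : TorusSite 2 L} (hQ : ¬ IsPairClassAt L Qm (n + 1))
    (hZ : ∀ Λ ∈ Icc (klScale klE0 (n + 1)) (klScale klE0 n), hubbardEffPartitionFnCT L M β U μ 0 (klFlowFrameU L M β U μ n) Λ ≠ 0)
    {P : SplitConsts} {m : ℝ} (hm0 : 0 ≤ m) (hm : m ^ 2 ≤ 2 ^ 8 * (P.Klam * U) ^ 2) (hAm : ∀ t ∈ Icc (0 : ℝ) 1, ∀ x y, ‖A j Qm t x y‖ ≤ m)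
    (x y : TorusSite 2 L) {M4 RH RL : ℝ} (hM40 : 0 ≤ M4) (hM4 : ∀ t ∈ Icc (0 : ℝ) 1, ∀ X, ‖V j t X‖ ≤ M4)
    (hM4K : M4 * M4 ≤ 2 ^ 3 * (P.Klam * U) ^ 2) (hM4KG : M4 * M4 * (4 + 8 / 3 * R.Gfr 1 * U ^ 2) ^ 2 ≤ 2 ^ 32 * (P.Klam * U) ^ 2)
    (hH : ∀ t ∈ Icc (0 : ℝ) 1, ‖Hd j t ![(((omega0 M, y), 0), 0), ((((omega0 M).rev, Qm - y), 1), 0), ((((omega0 M).rev, Qm - x), 1), 1), (((omega0 M, x), 0), 1)]‖ ≤ RH)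
    (hL : ∀ t ∈ Icc (0 : ℝ) 1, ‖∑ z : TorusSite 2 L × MatsubaraIdx M, Br j Qm t z *
          ((if z.1 ∈ klBall L μ 0 then
              V j t ![(((omega0 M, z.1), 0), 0), ((((omega0 M).rev, Qm - z.1), 1), 0), ((((omega0 M).rev, Qm - x), 1), 1), (((omega0 M, x), 0), 1)] *
                V j t ![(((omega0 M, y), 0), 0), ((((omega0 M).rev, Qm - y), 1), 0), ((((omega0 M).rev, Qm - z.1), 1), 1), (((omega0 M, z.1), 0), 1)]
            else 0) -
            V j t ![(((z.2, z.1), 0), 0), (((z.2.rev, Qm - z.1), 1), 0), ((((omega0 M).rev, Qm - x), 1), 1), (((omega0 M, x), 0), 1)] *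
              V j t ![(((omega0 M, y), 0), 0), ((((omega0 M).rev, Qm - y), 1), 0), (((z.2.rev, Qm - z.1), 1), 1), (((z.2, z.1), 0), 1)])‖ ≤ RL)
    (c₀ : ℂ) (F₁ : ℝ → FreqMomentum L M → Fin 2 → FreqMomentum L M → ℂ) {ι' : Type*} [Fintype ι'] (F₂ : ι' → ℝ → FreqMomentum L M → Fin 2 → FreqMomentum L M → ℂ)
    (F₁₀ : ℝ → TorusSite 2 L → Fin 2 → TorusSite 2 L → ℂ)
    (hsplit : ∀ t ∈ Icc (0 : ℝ) 1, ∀ (p : FreqMomentum L M) (σ : Fin 2) (p' : FreqMomentum L M),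
      V j t ![((p, σ), 1), ((p', σ), 0), (((omega0 M, y), 0), 0), (((omega0 M, x), 0), 1)] *
          V j t ![((p, σ), 0), ((p', σ), 1), ((((omega0 M).rev, Qm - y), 1), 0), ((((omega0 M).rev, Qm - x), 1), 1)] = c₀ + F₁ t p σ p' + ∑ w, F₂ w t p σ p')
    (Fx₁ : ℝ → FreqMomentum L M → FreqMomentum L M → ℂ) (Fx₂ : ι' → ℝ → FreqMomentum L M → FreqMomentum L M → ℂ) (Fx₁₀ : ℝ → TorusSite 2 L → TorusSite 2 L → ℂ)
    (hsplitX : ∀ t ∈ Icc (0 : ℝ) 1, ∀ (p p' : FreqMomentum L M),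
      V j t ![((p, 0), 1), ((p', 1), 0), (((omega0 M, y), 0), 0), ((((omega0 M).rev, Qm - x), 1), 1)] *
          V j t ![((p, 0), 0), ((p', 1), 1), ((((omega0 M).rev, Qm - y), 1), 0), (((omega0 M, x), 0), 1)] = c₀ + Fx₁ t p p' + ∑ w, Fx₂ w t p p')
    {A₁ Kg ε₁ : ℝ} (hA1 : 0 ≤ A₁) (hKg : 0 ≤ Kg) (hε1 : 0 ≤ ε₁)
    (hY0p₁ : ∀ t ∈ Icc (0 : ℝ) 1, ∀ k : TorusSite 2 L, ‖∑ σ : Fin 2, F₁₀ t k σ (k + (x - y))‖ ≤ A₁)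
    (hY1p₁ : ∀ t ∈ Icc (0 : ℝ) 1, ∀ k k' : TorusSite 2 L,
      ‖(∑ σ : Fin 2, F₁₀ t k σ (k + (x - y))) - ∑ σ : Fin 2, F₁₀ t k' σ (k' + (x - y))‖ ≤ Kg * klTorusNorm L (k - k'))
    (hY0m₁ : ∀ t ∈ Icc (0 : ℝ) 1, ∀ k : TorusSite 2 L, ‖∑ σ : Fin 2, F₁₀ t (k + -(x - y)) σ k‖ ≤ A₁)
    (hY1m₁ : ∀ t ∈ Icc (0 : ℝ) 1, ∀ k k' : TorusSite 2 L,
      ‖(∑ σ : Fin 2, F₁₀ t (k + -(x - y)) σ k) - ∑ σ : Fin 2, F₁₀ t (k' + -(x - y)) σ k'‖ ≤ Kg * klTorusNorm L (k - k'))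
    {ι : Type*} [Fintype ι] {S : ι → Finset (TorusSite 2 L)} {αc βc Lc : ι → ℝ} (hαβ : ∀ c, αc c ≤ βc c) (hLc : ∀ c, 0 ≤ Lc c)
    {r : ℝ} (hr : 4 * klScale klE0 (n + 1) / (B.Dtmin - 4 * Af) + Real.pi / L ≤ r)
    (hserve : ∀ c, ∀ θ ∈ Icc (αc c) (βc c), ∀ k : TorusSite 2 L,
      torusSupNorm (klpeP L k -
        (perturbedFermiRadius (fun k : Fin 2 → ℝ => frameShift (klFlowFrameU L M β U μ n) (WithLp.toLp 2 k)) μ θ * Real.cos θ,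
          perturbedFermiRadius (fun k : Fin 2 → ℝ => frameShift (klFlowFrameU L M β U μ n) (WithLp.toLp 2 k)) μ θ * Real.sin θ)) ≤ r → k ∈ S c)
    (hcover : ∀ θ ∈ Ioo (-π) π, ∃ c, θ ∈ Icc (αc c) (βc c))
    (hcellp : ∀ t ∈ Icc (0 : ℝ) 1, ∀ c, ∀ k ∈ S c, ∀ k' ∈ S c,
      ‖(∑ σ : Fin 2, F₁₀ t k σ (k + (x - y))) - ∑ σ : Fin 2, F₁₀ t k' σ (k' + (x - y))‖ ≤ Lc c * klTorusNorm L (k - k'))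
    (hcellm : ∀ t ∈ Icc (0 : ℝ) 1, ∀ c, ∀ k ∈ S c, ∀ k' ∈ S c,
      ‖(∑ σ : Fin 2, F₁₀ t (k + -(x - y)) σ k) - ∑ σ : Fin 2, F₁₀ t (k' + -(x - y)) σ k'‖ ≤ Lc c * klTorusNorm L (k - k'))
    (hflat₁ : ∀ t ∈ Icc (0 : ℝ) 1, ∀ (i : MatsubaraIdx M) (σ : Fin 2) (k k' : TorusSite 2 L), matsubaraFreq β M i ^ 2 ≤ (4 * klScale klE0 (n + 1)) ^ 2 →
      ‖F₁ t (i, k) σ (i, k') - F₁₀ t k σ k'‖ ≤ ε₁)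
    (hY0B₁ : ∀ t ∈ Icc (0 : ℝ) 1, ∀ k : TorusSite 2 L, ‖Fx₁₀ t k (k + (Qm - x - y))‖ ≤ A₁)
    (hY1B₁ : ∀ t ∈ Icc (0 : ℝ) 1, ∀ k k' : TorusSite 2 L, ‖Fx₁₀ t k (k + (Qm - x - y)) - Fx₁₀ t k' (k' + (Qm - x - y))‖ ≤ Kg * klTorusNorm L (k - k'))
    (hY0A₁ : ∀ t ∈ Icc (0 : ℝ) 1, ∀ k : TorusSite 2 L, ‖Fx₁₀ t (k + -(Qm - x - y)) k‖ ≤ A₁)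
    (hY1A₁ : ∀ t ∈ Icc (0 : ℝ) 1, ∀ k k' : TorusSite 2 L, ‖Fx₁₀ t (k + -(Qm - x - y)) k - Fx₁₀ t (k' + -(Qm - x - y)) k'‖ ≤ Kg * klTorusNorm L (k - k'))
    (hcellB : ∀ t ∈ Icc (0 : ℝ) 1, ∀ c, ∀ k ∈ S c, ∀ k' ∈ S c, ‖Fx₁₀ t k (k + (Qm - x - y)) - Fx₁₀ t k' (k' + (Qm - x - y))‖ ≤ Lc c * klTorusNorm L (k - k'))
    (hcellA : ∀ t ∈ Icc (0 : ℝ) 1, ∀ c, ∀ k ∈ S c, ∀ k' ∈ S c, ‖Fx₁₀ t (k + -(Qm - x - y)) k - Fx₁₀ t (k' + -(Qm - x - y)) k'‖ ≤ Lc c * klTorusNorm L (k - k'))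
    (hflatX₁ : ∀ t ∈ Icc (0 : ℝ) 1, ∀ (i i' : MatsubaraIdx M) (k k' : TorusSite 2 L), matsubaraInt M i' + 1 = matsubaraInt M i →
      matsubaraFreq β M i ^ 2 ≤ (5 * klScale klE0 (n + 1)) ^ 2 → ‖Fx₁ t (i, k) (i', k') - Fx₁₀ t k k'‖ ≤ ε₁)
    (cen cenx : ι' → TorusSite 2 L) {ρw A₂ : ι' → ℝ} (hρw : ∀ w, 0 ≤ ρw w) (hA2 : ∀ w, 0 ≤ A₂ w)
    (hF₂ : ∀ t ∈ Icc (0 : ℝ) 1, ∀ w (p : FreqMomentum L M) (σ : Fin 2) (p' : FreqMomentum L M), ‖F₂ w t p σ p'‖ ≤ A₂ w)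
    (hsupp₂ : ∀ t ∈ Icc (0 : ℝ) 1, ∀ w (p : FreqMomentum L M) (σ : Fin 2) (p' : FreqMomentum L M), ρw w < klTorusNorm L (p.2 - cen w) → F₂ w t p σ p' = 0)
    (hFx₂ : ∀ t ∈ Icc (0 : ℝ) 1, ∀ w (p p' : FreqMomentum L M), ‖Fx₂ w t p p'‖ ≤ A₂ w)
    (hsuppx₂ : ∀ t ∈ Icc (0 : ℝ) 1, ∀ w (p p' : FreqMomentum L M), ρw w < klTorusNorm L (p.2 - cenx w) → Fx₂ w t p p' = 0)
    {A₀S LAS εS : ℝ} (hA0S : 0 ≤ A₀S) (hLAS : 0 ≤ LAS) (hεS : 0 ≤ εS)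
    (hY0S : ∀ t ∈ Icc (0 : ℝ) 1, ∀ k : TorusSite 2 L, ‖∑ σ : Fin 2, V6 j t ![(((omega0 M, k), σ), 0), (((omega0 M, k), σ), 1), (((omega0 M, y), 0), 0), ((((omega0 M).rev, Qm - y), 1), 0),
        ((((omega0 M).rev, Qm - x), 1), 1), (((omega0 M, x), 0), 1)] * Sg j t (omega0 M, k) σ‖ ≤ A₀S)
    (hY1S : ∀ t ∈ Icc (0 : ℝ) 1, ∀ k k' : TorusSite 2 L, ‖(∑ σ : Fin 2, V6 j t ![(((omega0 M, k), σ), 0), (((omega0 M, k), σ), 1), (((omega0 M, y), 0), 0), ((((omega0 M).rev, Qm - y), 1), 0),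
          ((((omega0 M).rev, Qm - x), 1), 1), (((omega0 M, x), 0), 1)] * Sg j t (omega0 M, k) σ) -
        ∑ σ : Fin 2, V6 j t ![(((omega0 M, k'), σ), 0), (((omega0 M, k'), σ), 1), (((omega0 M, y), 0), 0), ((((omega0 M).rev, Qm - y), 1), 0),
          ((((omega0 M).rev, Qm - x), 1), 1), (((omega0 M, x), 0), 1)] * Sg j t (omega0 M, k') σ‖ ≤ LAS * klTorusNorm L (k - k'))
    (hflatS : ∀ t ∈ Icc (0 : ℝ) 1, ∀ (i : MatsubaraIdx M) (σ : Fin 2) (k : TorusSite 2 L), matsubaraFreq β M i ^ 2 ≤ (4 * klScale klE0 (n + 1)) ^ 2 →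
      ‖V6 j t ![(((i, k), σ), 0), (((i, k), σ), 1), (((omega0 M, y), 0), 0), ((((omega0 M).rev, Qm - y), 1), 0), ((((omega0 M).rev, Qm - x), 1), 1),
              (((omega0 M, x), 0), 1)] * Sg j t (i, k) σ -
          V6 j t ![(((omega0 M, k), σ), 0), (((omega0 M, k), σ), 1), (((omega0 M, y), 0), 0), ((((omega0 M).rev, Qm - y), 1), 0), ((((omega0 M).rev, Qm - x), 1), 1),
              (((omega0 M, x), 0), 1)] * Sg j t (omega0 M, k) σ‖ ≤ εS)
    (hTHS : (393216 / Real.pi * (64 * (klScale klE0 (n + 1) / klScale klE0 j) ^ 2 + (2 * (448 / 3 * Real.exp 2) + 8) + 64) * (2 * A₀S * (Real.pi * Real.sqrt 2 / (B.Dtmin - 4 * Af)))) ≤ 2 ^ 77 * (P.Klam * U) ^ 2)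
    (hZS : 64 / Real.pi * 8 * (Real.pi * Real.sqrt 2 / (B.Dtmin - 4 * Af) / (B.Dtmin - 4 * Af)) * ((∑ c, Lc c * (βc c - αc c)) / (2 * π)) +
      64 / Real.pi * 8 * (Real.pi * Real.sqrt 2 / (B.Dtmin - 4 * Af) * (2 * (2 * ‖c₀‖ + A₁) * (2 / (1 / 10))) / (B.Dtmin - 4 * Af) + 2 * (2 * ‖c₀‖ + A₁) * (1 / (B.Dtmin - 4 * Af) ^ 2 + Real.pi * Real.sqrt 2 * (2 + 4 * Af) / (B.Dtmin - 4 * Af) ^ 3)) ≤ 2 ^ 52 * (P.Klam * U) ^ 2)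
    (hTH : (393216 / Real.pi * (64 * (klScale klE0 (n + 1) / klScale klE0 j) ^ 2 + (2 * (448 / 3 * Real.exp 2) + 8) + 64) * (2 * (2 * ‖c₀‖ + A₁) * (Real.pi * Real.sqrt 2 / (B.Dtmin - 4 * Af)))) ≤ 2 ^ 76 * (P.Klam * U) ^ 2)
    (hTHR : (393216 / Real.pi * (64 * (klScale klE0 (n + 1) / klScale klE0 j) ^ 2 + (2 * (448 / 3 * Real.exp 2) + 8) + 64) * (2 * (2 * ‖c₀‖ + A₁) * (Real.pi * Real.sqrt 2 / (B.Dtmin - 4 * Af)))) +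
      2 * (64 / Real.pi * 8 * (2 * (2 * ‖c₀‖ + A₁) * (Real.pi * Real.sqrt 2 / (B.Dtmin - 4 * Af))) * (3 * (8 * (16 : ℝ) ^ (j - (n + 1))) + 512 * 1) +
      4 * (48 / Real.pi * 8 * (2 * (2 * ‖c₀‖ + A₁) * (Real.pi * Real.sqrt 2 / (B.Dtmin - 4 * Af))) * (3 * (8 * (16 : ℝ) ^ (j - (n + 1))) + 512 * 1))) ≤ 2 ^ 76 * (P.Klam * U) ^ 2)
    (hTR : (64 / Real.pi * 8 * (2 * (2 * ‖c₀‖ + A₁) * (Real.pi * Real.sqrt 2 / (B.Dtmin - 4 * Af))) * (3 * (8 * (16 : ℝ) ^ (j - (n + 1))) + 512 * 1) +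
      4 * (48 / Real.pi * 8 * (2 * (2 * ‖c₀‖ + A₁) * (Real.pi * Real.sqrt 2 / (B.Dtmin - 4 * Af))) * (3 * (8 * (16 : ℝ) ^ (j - (n + 1))) + 512 * 1))) * (4 + 8 / 3 * R.Gfr 1 * U ^ 2) ≤ 2 ^ 52 * (P.Klam * U) ^ 2)
    (Q : EngConsts) (hKlam : 0 ≤ P.Klam) (hCR : 0 ≤ Q.CR) {s : ℝ} (hs : 0 ≤ s)
    (hShareHd : (klScale klE0 n - klScale klE0 (n + 1)) * (2⁻¹ * RH) ≤ s * (klEngGeo11.cloc * (P.Klam * U) ^ 2 * (4 : ℝ) ^ (-(klEngGeo11.θ * n))))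
    (hShareRL : RL + 2 * (3 / π * (128 / Real.pi * 8 * (Real.pi * Real.sqrt 2 / (B.Dtmin - 4 * Af)) * ((∑ c, (2 * Lc c + 4 * Kg) * (Real.pi / L) * (βc c - αc c)) / (2 * π)))) ≤ s * (Q.CL β n / L))
    (hShareLat : (β ^ 2 + 1) * (2 ^ 18 * (Kg + LAS / 2) + 2 ^ 30 * ((2 * ‖c₀‖ + A₁) + A₀S / 2) * (4 + 8 / 3 * R.Gfr 1 * U ^ 2) * (16 : ℝ) ^ (j - (n + 1))) ≤ s * Q.CL β n)
    (hShareBorn : (524288 / Real.pi * (64 * (klScale klE0 (n + 1) / klScale klE0 j) ^ 2 + (2 * (448 / 3 * Real.exp 2) + 8) + 64) * (Real.pi * Real.sqrt 2 / (B.Dtmin - 4 * Af) * (2 * LAS + 2 * A₀S * (2 / (1 / 10))) / (B.Dtmin - 4 * Af) + 2 * A₀S * (1 / (B.Dtmin - 4 * Af) ^ 2 + Real.pi * Real.sqrt 2 * (2 + 4 * Af) / (B.Dtmin - 4 * Af) ^ 3))) * klE0 ≤ 4 * s * (Q.CR * (P.Klam * |U|) ^ 3))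
    (hShareEps : 2 * (ε₁ * (2048 * 15367) + ∑ w, A₂ w * (4096 * 15381) * (ρw w / π + ((L : ℝ))⁻¹)) + 2 * (εS * (2048 * 15367)) ≤ s * (klEngGeo11.cloc * (P.Klam * U) ^ 2 * (4 : ℝ) ^ (-(klEngGeo11.θ * n))) + s * (Q.CR * (P.Klam * |U|) ^ 3 * ((2 : ℝ) ^ n)⁻¹))
    (hj1 : j = n + 1) (hx : x ∈ klBall L μ 0) (hy : y ∈ klBall L μ 0)
    (Tb : TorusSite 2 L → TorusSite 2 L → TorusSite 2 L → ℝ) (Nr : Matrix (TorusSite 2 L) (TorusSite 2 L) ℂ)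
    (hNr : (1 - diagonal (fun p => ((klTransferWeight L M β μ (klFlowFrameU L M β U μ n) n (softSymbolCompl L M β μ (klFlowFrameU L M β U μ n) n (n + 1)) Qm p -
          klTransferWeight L M β μ (klFlowFrameU L M β U μ n) n (fun _ => 0) Qm p : ℝ) : ℂ)) * klMemberArrayF L M β U μ n (fun _ => 0) Qm) * Nr = 1)
    (hdef : ∀ k ∈ klBall L μ 0, ∀ k' ∈ klBall L μ 0,
      ‖klMemberArrayF L M β U μ n (softSymbolCompl L M β μ (klFlowFrameU L M β U μ n) n (n + 1)) Qm k k' -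
          (klMemberArrayF L M β U μ n (fun _ => 0) Qm * Nr) k k'‖ ≤ Tb Qm k k')
    {m' : ℝ} (hm' : 0 ≤ m') (hm'K : m' ^ 2 ≤ 2 ^ 8 * (P.Klam * U) ^ 2) (hA' : ∀ s t, ‖klPairArrayF L M β U μ n Qm s t‖ ≤ m')
    (hsm : m' * ∑ p, |klTransferWeight L M β μ (klFlowFrameU L M β U μ n) n (softSymbolCompl L M β μ (klFlowFrameU L M β U μ n) n (n + 1)) Qm p| ≤ 1 / 3)
    (hsoft : ∀ k, 0 ≤ softSymbolCompl L M β μ (klFlowFrameU L M β U μ n) n (n + 1) k ∧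
      softSymbolCompl L M β μ (klFlowFrameU L M β U μ n) n (n + 1) k ≤ 1 - hubbardCutoffWeightCT L M β μ (klFlowFrameU L M β U μ n) (klScale klE0 n) k)
    {E₂ Ebar : ℝ} (hTb : Tb Qm x y ≤ (2 : ℝ)⁻¹ ^ 15 * ((P.Klam * U) ^ 2 * (klEngGeo14.phGain (n + 1) (klTorusNorm L (x - y)) + klEngGeo14.phGain (n + 1) (klTorusNorm L (x + y - Qm)))) +
      E₂ + (2 : ℝ)⁻¹ ^ 5 * thermalBar klEngGeo14 P U β (n + 1))
    (hE : 2 * s * eremBar klEngGeo11 P Q U β L n + E₂ ≤ Ebar)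
    (hshift : ‖klPairAmplitude L M β U μ (klFlowFrameU L M β U μ (n + 1)) (n + 1) Qm x y - klPairAmplitude L M β U μ (klFlowFrameU L M β U μ n) (n + 1) Qm x y‖ ≤
      frameShiftBar P Q U (n + 1)) :
    ‖klPairAmplitude L M β U μ (klFlowFrameU L M β U μ (n + 1)) (n + 1) Qm x y - klPairAmplitude L M β U μ (klFlowFrameU L M β U μ n) n Qm x y‖ ≤
      gainBar klEngGeo14 P U (n + 1) (klTorusNorm L Qm) (klTorusNorm L (x - y)) (klTorusNorm L (x + y - Qm)) +
        Ebar + thermalBar klEngGeo14 P U β (n + 1) +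
          legDressBarQ2 klEngGeo14 P Q U (n + 1) (legSliceCountT L β μ (klFlowFrameU L M β U μ (n + 1)) (n + 1) ![y, Qm - y, Qm - x, x]) +
            frameShiftBar P Q U (n + 1) := by
  -- step (i) at the frame `Kₙ`, erem share `s`
  have h₁ := outClass_sameFrame_le_bars_share_cells L M β U μ (klFlowFrameU L M β U μ n) B hR hU hUu hμC hK hβ hβL hn hGL hGU hAb hA hA20 hμ hlo hhi hM A A' b' hAdef hA'def hb'def V hV V6 hV6 Sg hSg Hd hHd Φ hΦ Wd hWd Br hBr j hj hQ hZ hm0 hm hAm x y hM40 hM4 hM4K hM4KG hH hL c₀ F₁ F₂ F₁₀ hsplit Fx₁ Fx₂ Fx₁₀ hsplitX hA1 hKg hε1 hY0p₁ hY1p₁ hY0m₁ hY1m₁ hαβ hLc hr hserve hcover hcellp hcellm hflat₁ hY0B₁ hY1B₁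
    hY0A₁ hY1A₁ hcellB hcellA hflatX₁ cen cenx hρw hA2 hF₂ hsupp₂ hFx₂ hsuppx₂ hA0S hLAS hεS hY0S hY1S hflatS hTHS hZS hTH hTHR hTR Q hKlam hCR hs hShareHd hShareRL hShareLat hShareBorn hShareEps
  subst hj1
  obtain ⟨e1, e0⟩ := outClass_endpoints_eq_plain L M β U μ (klFlowFrameU L M β U μ n) n A A' hAdef hA'def hZ hx hy
  rw [e1, e0] at h₁
  have hc : klCovSmearedPairAmplitude L M β U μ (klFlowFrameU L M β U μ n) n
      (softCovOf L M β μ (klFlowFrameU L M β U μ n) (softSymbolCompl L M β μ (klFlowFrameU L M β U μ n) n (n + 1))) Qm x y =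
      klMemberArrayF L M β U μ n (softSymbolCompl L M β μ (klFlowFrameU L M β U μ n) n (n + 1)) Qm x y :=
    (klMemberArrayF_apply_of_mem β U μ n _ Qm hx hy).symm
  have hd : klPairArrayF L M β U μ n Qm x y = klPairAmplitude L M β U μ (klFlowFrameU L M β U μ n) n Qm x y := klPairArrayF_apply_of_mem L M β U μ n Qm hx hy
  rw [hc] at h₁
  -- step (iii): the frozen total momentum `Λₙ ≤ |p_Qm|` from `¬IsPairClassAt Qm (n+1)`
  have hΛρ : klScale klE0 n ≤ klTorusNorm L Qm := by
    have hQ' := hQ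
    unfold IsPairClassAt at hQ'
    push Not at hQ'
    have e : klScale klE0 n = 8⁻¹ * ((4 : ℝ) ^ (n + 1))⁻¹ := by
      show klE0 * ((4 : ℝ) ^ n)⁻¹ = 8⁻¹ * ((4 : ℝ) ^ (n + 1))⁻¹
      unfold klE0; rw [pow_succ, mul_inv]; ring
    have hle : ((4 : ℝ) ^ (n + 1))⁻¹ ≤ klTorusNorm L Qm := hQ'.le
    have h0 : 0 ≤ ((4 : ℝ) ^ (n + 1))⁻¹ := by positivity
    rw [e]; linarith
  have h₃ := member_sub_plain_le_shellLog β U μ hR hU hUu hμC hK hβ hβL hn hGL hGU hsoft Qm Tb Nr hNr hdef hm' hm'K hA' hsm hΛρ hx hy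
  rw [hd] at h₃
  have hρ0 : 0 ≤ klTorusNorm L Qm := (klth_klScale_pos n).le.trans hΛρ
  have hD : 0 ≤ legDressBarQ2 klEngGeo14 P Q U (n + 1) (legSliceCountT L β μ (klFlowFrameU L M β U μ (n + 1)) (n + 1) ![y, Qm - y, Qm - x, x]) :=
    legDressBarQ2_nonneg klEngGeo14 hKlam hCR U (n + 1) _
  have hρd : 0 ≤ klTorusNorm L (x - y) := by unfold klTorusNorm; exact torusSupNorm_nonneg _
  have hρx : 0 ≤ klTorusNorm L (x + y - Qm) := by unfold klTorusNorm; exact torusSupNorm_nonneg _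
  exact outClass_hout_le_bars_klEngGeo14_of_shares hρ0 hρd hρx hshift h₁ h₃ hTb hE hD

set_option maxHeartbeats 2400000 in -- ~90 literal binders; plumbing only
/-- **The same FROM THE RAW RELATIVE TRIPLE of the all-`Qm` spine** (as `outClass_hout_klEngGeo13_of_raw`: `(Tb, Nr, hNr, hdef)` read from `hraw` at the pair `(n+1, n)`). -/
theorem outClass_hout_klEngGeo14_of_shares_of_raw_cells (hR : R.WF2) (hU : 0 < U) (hUu : U ≤ klTSU R) (hμC : μ ∈ klWindowC)
    (hβ : klBetaMin ≤ β) (hβL : β ≤ L) {n : ℕ} (hn : n ≤ nScales β) (hK : FrameOK R U N μ (klFlowFrameU L M β U μ n)) (hGL : 8 * (4 + 8 / 3 * R.Gfr 1 * U ^ 2) * β ≤ L) (hGU : 8 / 3 * R.Gfr 1 * U ^ 2 ≤ 1)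
    (hAb : ∀ p : Momentum, ∀ j ≤ 2, ‖iteratedFDeriv ℝ j (frameShift (klFlowFrameU L M β U μ n)) p‖ ≤ Af) (hA : 4 * Af < B.Dtmin) (hA20 : 4 * Af ≤ 1 / 20) (hμ : μ ≤ -0.15)
    (hlo : a' < μ - 4 * klScale klE0 (n + 1) - 4 * Af) (hhi : μ + 4 * klScale klE0 (n + 1) + 4 * Af < b')
    (hM : β * (4 * klScale klE0 (n + 1)) / (2 * Real.pi) + 1 ≤ M)
    (A A' : ℕ → TorusSite 2 L → ℝ → Matrix (TorusSite 2 L) (TorusSite 2 L) ℂ) (b' : ℕ → TorusSite 2 L → ℝ → TorusSite 2 L → ℂ)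
    (hAdef : A = fun j Qm t => Matrix.of fun k k' : TorusSite 2 L => if k ∈ klBall L μ 0 ∧ k' ∈ klBall L μ 0 then
      vertexFn L M β (gaussConv ℂ (softCovOf L M β μ (klFlowFrameU L M β U μ n) (softSymbolCompl L M β μ (klFlowFrameU L M β U μ n) (n + 1) j) + hubbardCovAboveCT L M β μ 0 (klFlowFrameU L M β U μ n) (klScale klE0 (n + 1)) - hubbardCovAboveCT L M β μ 0 (klFlowFrameU L M β U μ n)
              (klScale klE0 n + t * (klScale klE0 (n + 1) - klScale klE0 n))) (hubbardEffectiveActionCT L M β U μ 0 (klFlowFrameU L M β U μ n) (klScale klE0 n + t * (klScale klE0 (n + 1) - klScale klE0 n)))) 4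
              ![(((omega0 M, k'), 0), 0), ((((omega0 M).rev, Qm - k'), 1), 0), ((((omega0 M).rev, Qm - k), 1), 1), (((omega0 M, k), 0), 1)]
      else 0)
    (hA'def : A' = fun j Qm t => Matrix.of fun k k' : TorusSite 2 L => if k ∈ klBall L μ 0 ∧ k' ∈ klBall L μ 0 then
      (klScale klE0 (n + 1) - klScale klE0 n) • -((2 : ℂ)⁻¹ * vertexFn L M β (gaussConv ℂ (softCovOf L M β μ (klFlowFrameU L M β U μ n) (softSymbolCompl L M β μ (klFlowFrameU L M β U μ n) (n + 1) j) + hubbardCovAboveCT L M β μ 0 (klFlowFrameU L M β U μ n)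
              (klScale klE0 (n + 1)) - hubbardCovAboveCT L M β μ 0 (klFlowFrameU L M β U μ n) (klScale klE0 n + t * (klScale klE0 (n + 1) - klScale klE0 n))) (grassmannDerivPairing ℂ (Matrix.of fun X Y :
              HubbardFieldIdx L M => deriv (fun Λ'' : ℝ => hubbardCovAboveCT L M β μ 0 (klFlowFrameU L M β U μ n) Λ'' X Y) (klScale klE0 n + t * (klScale klE0 (n + 1) - klScale klE0 n)))
              (hubbardEffectiveActionCT L M β U μ 0 (klFlowFrameU L M β U μ n) (klScale klE0 n + t * (klScale klE0 (n + 1) - klScale klE0 n))) (hubbardEffectiveActionCT L M β U μ 0 (klFlowFrameU L M β U μ n) (klScale klE0 n + t *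
              (klScale klE0 (n + 1) - klScale klE0 n))))) 4 ![(((omega0 M, k'), 0), 0), ((((omega0 M).rev, Qm - k'), 1), 0), ((((omega0 M).rev, Qm - k), 1), 1), (((omega0 M, k), 0),
              1)])
      else 0)
    (hb'def : b' = fun (j : ℕ) (Qm : TorusSite 2 L) (t : ℝ) (p : TorusSite 2 L) => (((klScale klE0 (n + 1) - klScale klE0 n) *
        (klBubbleMass L M β μ (klFlowFrameU L M β U μ n) (fun k => deriv (fun Λ' => hubbardCutoffWeightCT L M β μ (klFlowFrameU L M β U μ n) Λ' k) (klScale klE0 n + t * (klScale klE0 (n + 1) - klScale klE0 n))) (fun k =>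
                (softSymbolCompl L M β μ (klFlowFrameU L M β U μ n) (n + 1) j) k + (hubbardCutoffWeightCT L M β μ (klFlowFrameU L M β U μ n) (klScale klE0 (n + 1)) k - hubbardCutoffWeightCT L M β μ (klFlowFrameU L M β U μ n) (klScale klE0 n + t * (klScale
                klE0 (n + 1) - klScale klE0 n)) k)) Qm p +
          klBubbleMass L M β μ (klFlowFrameU L M β U μ n) (fun k => (softSymbolCompl L M β μ (klFlowFrameU L M β U μ n) (n + 1) j) k + (hubbardCutoffWeightCT L M β μ (klFlowFrameU L M β U μ n) (klScale klE0 (n + 1)) k - hubbardCutoffWeightCT L M β μ (klFlowFrameU L M β U μ n)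
                  (klScale klE0 n + t * (klScale klE0 (n + 1) - klScale klE0 n)) k)) (fun k => deriv (fun Λ' => hubbardCutoffWeightCT L M β μ (klFlowFrameU L M β U μ n) Λ' k) (klScale klE0 n + t * (klScale
                  klE0 (n + 1) - klScale klE0 n))) Qm p) : ℝ) : ℂ))
    (V : ℕ → ℝ → (Fin 4 → HubbardFieldIdx L M) → ℂ) (hV : V = fun j t X => vertexFn L M β (gaussConv ℂ (softCovOf L M β μ (klFlowFrameU L M β U μ n) (softSymbolCompl L M β μ (klFlowFrameU L M β U μ n) (n + 1) j) + hubbardCovAboveCT L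
            M β μ 0 (klFlowFrameU L M β U μ n) (klScale klE0 (n + 1)) - hubbardCovAboveCT L M β μ 0 (klFlowFrameU L M β U μ n) (klScale klE0 n + t * (klScale klE0 (n + 1) - klScale klE0 n))) (hubbardEffectiveActionCT L M β U μ 0 (klFlowFrameU L M β U μ n)
            (klScale klE0 n + t * (klScale klE0 (n + 1) - klScale klE0 n)))) 4 X)
    (V6 : ℕ → ℝ → (Fin 6 → HubbardFieldIdx L M) → ℂ) (hV6 : V6 = fun j t X => vertexFn L M β (gaussConv ℂ (softCovOf L M β μ (klFlowFrameU L M β U μ n) (softSymbolCompl L M β μ (klFlowFrameU L M β U μ n) (n + 1) j) + hubbardCovAboveCT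
            L M β μ 0 (klFlowFrameU L M β U μ n) (klScale klE0 (n + 1)) - hubbardCovAboveCT L M β μ 0 (klFlowFrameU L M β U μ n) (klScale klE0 n + t * (klScale klE0 (n + 1) - klScale klE0 n))) (hubbardEffectiveActionCT L M β U μ 0 (klFlowFrameU L M β U μ n)
            (klScale klE0 n + t * (klScale klE0 (n + 1) - klScale klE0 n)))) 6 X)
    (Sg : ℕ → ℝ → FreqMomentum L M → Fin 2 → ℂ) (hSg : Sg = fun j t p σ => selfEnergy L M β (gaussConv ℂ (softCovOf L M β μ (klFlowFrameU L M β U μ n) (softSymbolCompl L M β μ (klFlowFrameU L M β U μ n) (n + 1) j) + hubbardCovAboveCT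
            L M β μ 0 (klFlowFrameU L M β U μ n) (klScale klE0 (n + 1)) - hubbardCovAboveCT L M β μ 0 (klFlowFrameU L M β U μ n) (klScale klE0 n + t * (klScale klE0 (n + 1) - klScale klE0 n))) (hubbardEffectiveActionCT L M β U μ 0 (klFlowFrameU L M β U μ n)
            (klScale klE0 n + t * (klScale klE0 (n + 1) - klScale klE0 n)))) p σ)
    (Hd : ℕ → ℝ → (Fin 4 → HubbardFieldIdx L M) → ℂ) (hHd : Hd = fun j t X => vertexFn L M β (dblFold ℂ (grassmannLaplacian ℂ (crossCov ℂ (Matrix.of fun X Y : HubbardFieldIdx L M =>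
            deriv (fun Λ' : ℝ => hubbardCovAboveCT L M β μ 0 (klFlowFrameU L M β U μ n) Λ' X Y) (klScale klE0 n + t * (klScale klE0 (n + 1) - klScale klE0 n)))) ((gaussConv ℂ (crossCov ℂ (softCovOf L M β μ (klFlowFrameU L M β U μ n)
            (softSymbolCompl L M β μ (klFlowFrameU L M β U μ n) (n + 1) j) + hubbardCovAboveCT L M β μ 0 (klFlowFrameU L M β U μ n) (klScale klE0 (n + 1)) - hubbardCovAboveCT L M β μ 0 (klFlowFrameU L M β U μ n) (klScale klE0 n + t * (klScale klE0 (n + 1) -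
            klScale klE0 n)))) - grassmannLaplacian ℂ (crossCov ℂ (softCovOf L M β μ (klFlowFrameU L M β U μ n) (softSymbolCompl L M β μ (klFlowFrameU L M β U μ n) (n + 1) j) + hubbardCovAboveCT L M β μ 0 (klFlowFrameU L M β U μ n) (klScale klE0 (n + 1)) -
            hubbardCovAboveCT L M β μ 0 (klFlowFrameU L M β U μ n) (klScale klE0 n + t * (klScale klE0 (n + 1) - klScale klE0 n))))) (dblCopy ℂ 0 (gaussConv ℂ (softCovOf L M β μ (klFlowFrameU L M β U μ n) (softSymbolCompl L M β μ (klFlowFrameU L M β U μ n) (n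
            + 1) j) + hubbardCovAboveCT L M β μ 0 (klFlowFrameU L M β U μ n) (klScale klE0 (n + 1)) - hubbardCovAboveCT L M β μ 0 (klFlowFrameU L M β U μ n) (klScale klE0 n + t * (klScale klE0 (n + 1) - klScale klE0 n)))
            (hubbardEffectiveActionCT L M β U μ 0 (klFlowFrameU L M β U μ n) (klScale klE0 n + t * (klScale klE0 (n + 1) - klScale klE0 n)))) * dblCopy ℂ 1 (gaussConv ℂ (softCovOf L M β μ (klFlowFrameU L M β U μ n) (softSymbolCompl L
            M β μ (klFlowFrameU L M β U μ n) (n + 1) j) + hubbardCovAboveCT L M β μ 0 (klFlowFrameU L M β U μ n) (klScale klE0 (n + 1)) - hubbardCovAboveCT L M β μ 0 (klFlowFrameU L M β U μ n) (klScale klE0 n + t * (klScale klE0 (n + 1) - klScale klE0 n)))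
            (hubbardEffectiveActionCT L M β U μ 0 (klFlowFrameU L M β U μ n) (klScale klE0 n + t * (klScale klE0 (n + 1) - klScale klE0 n)))))))) 4 X)
    (Φ : ℕ → ℝ → FreqMomentum L M → ℝ) (hΦ : Φ = fun j t k => (softSymbolCompl L M β μ (klFlowFrameU L M β U μ n) (n + 1) j) k + (hubbardCutoffWeightCT L M β μ (klFlowFrameU L M β U μ n) (klScale klE0 (n + 1)) k -
            hubbardCutoffWeightCT L M β μ (klFlowFrameU L M β U μ n) (klScale klE0 n + t * (klScale klE0 (n + 1) - klScale klE0 n)) k))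
    (Wd : ℝ → FreqMomentum L M → ℝ) (hWd : Wd = fun t k => deriv (fun Λ' : ℝ => hubbardCutoffWeightCT L M β μ (klFlowFrameU L M β U μ n) Λ' k) (klScale klE0 n + t * (klScale klE0 (n + 1) - klScale klE0 n)))
    (Br : ℕ → TorusSite 2 L → ℝ → TorusSite 2 L × MatsubaraIdx M → ℂ) (hBr : Br = fun j Qm t z => -(((((β * (L : ℝ) ^ 2 : ℝ) : ℂ)))⁻¹ * propCT L M β μ (klFlowFrameU L M β U μ n) (z.2, z.1) * propCT L M β μ (klFlowFrameU L M β U μ n)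
            (z.2.rev, Qm - z.1)) *
      ((((klScale klE0 (n + 1) - klScale klE0 n) * (-Wd t (z.2, z.1) * Φ j t (z.2.rev, Qm - z.1) - Φ j t (z.2, z.1) * Wd t (z.2.rev, Qm - z.1))) : ℝ) : ℂ))
    (j : ℕ) (hj : n + 1 ≤ j) {Qm : TorusSite 2 L} (hQ : ¬ IsPairClassAt L Qm (n + 1))
    (hZ : ∀ Λ ∈ Icc (klScale klE0 (n + 1)) (klScale klE0 n), hubbardEffPartitionFnCT L M β U μ 0 (klFlowFrameU L M β U μ n) Λ ≠ 0)
    {P : SplitConsts} {m : ℝ} (hm0 : 0 ≤ m) (hm : m ^ 2 ≤ 2 ^ 8 * (P.Klam * U) ^ 2) (hAm : ∀ t ∈ Icc (0 : ℝ) 1, ∀ x y, ‖A j Qm t x y‖ ≤ m)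
    (x y : TorusSite 2 L) {M4 RH RL : ℝ} (hM40 : 0 ≤ M4) (hM4 : ∀ t ∈ Icc (0 : ℝ) 1, ∀ X, ‖V j t X‖ ≤ M4)
    (hM4K : M4 * M4 ≤ 2 ^ 3 * (P.Klam * U) ^ 2) (hM4KG : M4 * M4 * (4 + 8 / 3 * R.Gfr 1 * U ^ 2) ^ 2 ≤ 2 ^ 32 * (P.Klam * U) ^ 2)
    (hH : ∀ t ∈ Icc (0 : ℝ) 1, ‖Hd j t ![(((omega0 M, y), 0), 0), ((((omega0 M).rev, Qm - y), 1), 0), ((((omega0 M).rev, Qm - x), 1), 1), (((omega0 M, x), 0), 1)]‖ ≤ RH)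
    (hL : ∀ t ∈ Icc (0 : ℝ) 1, ‖∑ z : TorusSite 2 L × MatsubaraIdx M, Br j Qm t z *
          ((if z.1 ∈ klBall L μ 0 then
              V j t ![(((omega0 M, z.1), 0), 0), ((((omega0 M).rev, Qm - z.1), 1), 0), ((((omega0 M).rev, Qm - x), 1), 1), (((omega0 M, x), 0), 1)] *
                V j t ![(((omega0 M, y), 0), 0), ((((omega0 M).rev, Qm - y), 1), 0), ((((omega0 M).rev, Qm - z.1), 1), 1), (((omega0 M, z.1), 0), 1)]
            else 0) -
            V j t ![(((z.2, z.1), 0), 0), (((z.2.rev, Qm - z.1), 1), 0), ((((omega0 M).rev, Qm - x), 1), 1), (((omega0 M, x), 0), 1)] *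
              V j t ![(((omega0 M, y), 0), 0), ((((omega0 M).rev, Qm - y), 1), 0), (((z.2.rev, Qm - z.1), 1), 1), (((z.2, z.1), 0), 1)])‖ ≤ RL)
    (c₀ : ℂ) (F₁ : ℝ → FreqMomentum L M → Fin 2 → FreqMomentum L M → ℂ) {ι' : Type*} [Fintype ι'] (F₂ : ι' → ℝ → FreqMomentum L M → Fin 2 → FreqMomentum L M → ℂ)
    (F₁₀ : ℝ → TorusSite 2 L → Fin 2 → TorusSite 2 L → ℂ)
    (hsplit : ∀ t ∈ Icc (0 : ℝ) 1, ∀ (p : FreqMomentum L M) (σ : Fin 2) (p' : FreqMomentum L M),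
      V j t ![((p, σ), 1), ((p', σ), 0), (((omega0 M, y), 0), 0), (((omega0 M, x), 0), 1)] *
          V j t ![((p, σ), 0), ((p', σ), 1), ((((omega0 M).rev, Qm - y), 1), 0), ((((omega0 M).rev, Qm - x), 1), 1)] = c₀ + F₁ t p σ p' + ∑ w, F₂ w t p σ p')
    (Fx₁ : ℝ → FreqMomentum L M → FreqMomentum L M → ℂ) (Fx₂ : ι' → ℝ → FreqMomentum L M → FreqMomentum L M → ℂ) (Fx₁₀ : ℝ → TorusSite 2 L → TorusSite 2 L → ℂ)
    (hsplitX : ∀ t ∈ Icc (0 : ℝ) 1, ∀ (p p' : FreqMomentum L M),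
      V j t ![((p, 0), 1), ((p', 1), 0), (((omega0 M, y), 0), 0), ((((omega0 M).rev, Qm - x), 1), 1)] *
          V j t ![((p, 0), 0), ((p', 1), 1), ((((omega0 M).rev, Qm - y), 1), 0), (((omega0 M, x), 0), 1)] = c₀ + Fx₁ t p p' + ∑ w, Fx₂ w t p p')
    {A₁ Kg ε₁ : ℝ} (hA1 : 0 ≤ A₁) (hKg : 0 ≤ Kg) (hε1 : 0 ≤ ε₁)
    (hY0p₁ : ∀ t ∈ Icc (0 : ℝ) 1, ∀ k : TorusSite 2 L, ‖∑ σ : Fin 2, F₁₀ t k σ (k + (x - y))‖ ≤ A₁)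
    (hY1p₁ : ∀ t ∈ Icc (0 : ℝ) 1, ∀ k k' : TorusSite 2 L,
      ‖(∑ σ : Fin 2, F₁₀ t k σ (k + (x - y))) - ∑ σ : Fin 2, F₁₀ t k' σ (k' + (x - y))‖ ≤ Kg * klTorusNorm L (k - k'))
    (hY0m₁ : ∀ t ∈ Icc (0 : ℝ) 1, ∀ k : TorusSite 2 L, ‖∑ σ : Fin 2, F₁₀ t (k + -(x - y)) σ k‖ ≤ A₁)
    (hY1m₁ : ∀ t ∈ Icc (0 : ℝ) 1, ∀ k k' : TorusSite 2 L,
      ‖(∑ σ : Fin 2, F₁₀ t (k + -(x - y)) σ k) - ∑ σ : Fin 2, F₁₀ t (k' + -(x - y)) σ k'‖ ≤ Kg * klTorusNorm L (k - k'))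
    {ι : Type*} [Fintype ι] {S : ι → Finset (TorusSite 2 L)} {αc βc Lc : ι → ℝ} (hαβ : ∀ c, αc c ≤ βc c) (hLc : ∀ c, 0 ≤ Lc c)
    {r : ℝ} (hr : 4 * klScale klE0 (n + 1) / (B.Dtmin - 4 * Af) + Real.pi / L ≤ r)
    (hserve : ∀ c, ∀ θ ∈ Icc (αc c) (βc c), ∀ k : TorusSite 2 L,
      torusSupNorm (klpeP L k -
        (perturbedFermiRadius (fun k : Fin 2 → ℝ => frameShift (klFlowFrameU L M β U μ n) (WithLp.toLp 2 k)) μ θ * Real.cos θ,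
          perturbedFermiRadius (fun k : Fin 2 → ℝ => frameShift (klFlowFrameU L M β U μ n) (WithLp.toLp 2 k)) μ θ * Real.sin θ)) ≤ r → k ∈ S c)
    (hcover : ∀ θ ∈ Ioo (-π) π, ∃ c, θ ∈ Icc (αc c) (βc c))
    (hcellp : ∀ t ∈ Icc (0 : ℝ) 1, ∀ c, ∀ k ∈ S c, ∀ k' ∈ S c,
      ‖(∑ σ : Fin 2, F₁₀ t k σ (k + (x - y))) - ∑ σ : Fin 2, F₁₀ t k' σ (k' + (x - y))‖ ≤ Lc c * klTorusNorm L (k - k'))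
    (hcellm : ∀ t ∈ Icc (0 : ℝ) 1, ∀ c, ∀ k ∈ S c, ∀ k' ∈ S c,
      ‖(∑ σ : Fin 2, F₁₀ t (k + -(x - y)) σ k) - ∑ σ : Fin 2, F₁₀ t (k' + -(x - y)) σ k'‖ ≤ Lc c * klTorusNorm L (k - k'))
    (hflat₁ : ∀ t ∈ Icc (0 : ℝ) 1, ∀ (i : MatsubaraIdx M) (σ : Fin 2) (k k' : TorusSite 2 L), matsubaraFreq β M i ^ 2 ≤ (4 * klScale klE0 (n + 1)) ^ 2 →
      ‖F₁ t (i, k) σ (i, k') - F₁₀ t k σ k'‖ ≤ ε₁)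
    (hY0B₁ : ∀ t ∈ Icc (0 : ℝ) 1, ∀ k : TorusSite 2 L, ‖Fx₁₀ t k (k + (Qm - x - y))‖ ≤ A₁)
    (hY1B₁ : ∀ t ∈ Icc (0 : ℝ) 1, ∀ k k' : TorusSite 2 L, ‖Fx₁₀ t k (k + (Qm - x - y)) - Fx₁₀ t k' (k' + (Qm - x - y))‖ ≤ Kg * klTorusNorm L (k - k'))
    (hY0A₁ : ∀ t ∈ Icc (0 : ℝ) 1, ∀ k : TorusSite 2 L, ‖Fx₁₀ t (k + -(Qm - x - y)) k‖ ≤ A₁)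
    (hY1A₁ : ∀ t ∈ Icc (0 : ℝ) 1, ∀ k k' : TorusSite 2 L, ‖Fx₁₀ t (k + -(Qm - x - y)) k - Fx₁₀ t (k' + -(Qm - x - y)) k'‖ ≤ Kg * klTorusNorm L (k - k'))
    (hcellB : ∀ t ∈ Icc (0 : ℝ) 1, ∀ c, ∀ k ∈ S c, ∀ k' ∈ S c, ‖Fx₁₀ t k (k + (Qm - x - y)) - Fx₁₀ t k' (k' + (Qm - x - y))‖ ≤ Lc c * klTorusNorm L (k - k'))
    (hcellA : ∀ t ∈ Icc (0 : ℝ) 1, ∀ c, ∀ k ∈ S c, ∀ k' ∈ S c, ‖Fx₁₀ t (k + -(Qm - x - y)) k - Fx₁₀ t (k' + -(Qm - x - y)) k'‖ ≤ Lc c * klTorusNorm L (k - k'))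
    (hflatX₁ : ∀ t ∈ Icc (0 : ℝ) 1, ∀ (i i' : MatsubaraIdx M) (k k' : TorusSite 2 L), matsubaraInt M i' + 1 = matsubaraInt M i →
      matsubaraFreq β M i ^ 2 ≤ (5 * klScale klE0 (n + 1)) ^ 2 → ‖Fx₁ t (i, k) (i', k') - Fx₁₀ t k k'‖ ≤ ε₁)
    (cen cenx : ι' → TorusSite 2 L) {ρw A₂ : ι' → ℝ} (hρw : ∀ w, 0 ≤ ρw w) (hA2 : ∀ w, 0 ≤ A₂ w)
    (hF₂ : ∀ t ∈ Icc (0 : ℝ) 1, ∀ w (p : FreqMomentum L M) (σ : Fin 2) (p' : FreqMomentum L M), ‖F₂ w t p σ p'‖ ≤ A₂ w)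
    (hsupp₂ : ∀ t ∈ Icc (0 : ℝ) 1, ∀ w (p : FreqMomentum L M) (σ : Fin 2) (p' : FreqMomentum L M), ρw w < klTorusNorm L (p.2 - cen w) → F₂ w t p σ p' = 0)
    (hFx₂ : ∀ t ∈ Icc (0 : ℝ) 1, ∀ w (p p' : FreqMomentum L M), ‖Fx₂ w t p p'‖ ≤ A₂ w)
    (hsuppx₂ : ∀ t ∈ Icc (0 : ℝ) 1, ∀ w (p p' : FreqMomentum L M), ρw w < klTorusNorm L (p.2 - cenx w) → Fx₂ w t p p' = 0)
    {A₀S LAS εS : ℝ} (hA0S : 0 ≤ A₀S) (hLAS : 0 ≤ LAS) (hεS : 0 ≤ εS)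
    (hY0S : ∀ t ∈ Icc (0 : ℝ) 1, ∀ k : TorusSite 2 L, ‖∑ σ : Fin 2, V6 j t ![(((omega0 M, k), σ), 0), (((omega0 M, k), σ), 1), (((omega0 M, y), 0), 0), ((((omega0 M).rev, Qm - y), 1), 0),
        ((((omega0 M).rev, Qm - x), 1), 1), (((omega0 M, x), 0), 1)] * Sg j t (omega0 M, k) σ‖ ≤ A₀S)
    (hY1S : ∀ t ∈ Icc (0 : ℝ) 1, ∀ k k' : TorusSite 2 L, ‖(∑ σ : Fin 2, V6 j t ![(((omega0 M, k), σ), 0), (((omega0 M, k), σ), 1), (((omega0 M, y), 0), 0), ((((omega0 M).rev, Qm - y), 1), 0),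
          ((((omega0 M).rev, Qm - x), 1), 1), (((omega0 M, x), 0), 1)] * Sg j t (omega0 M, k) σ) -
        ∑ σ : Fin 2, V6 j t ![(((omega0 M, k'), σ), 0), (((omega0 M, k'), σ), 1), (((omega0 M, y), 0), 0), ((((omega0 M).rev, Qm - y), 1), 0),
          ((((omega0 M).rev, Qm - x), 1), 1), (((omega0 M, x), 0), 1)] * Sg j t (omega0 M, k') σ‖ ≤ LAS * klTorusNorm L (k - k'))
    (hflatS : ∀ t ∈ Icc (0 : ℝ) 1, ∀ (i : MatsubaraIdx M) (σ : Fin 2) (k : TorusSite 2 L), matsubaraFreq β M i ^ 2 ≤ (4 * klScale klE0 (n + 1)) ^ 2 →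
      ‖V6 j t ![(((i, k), σ), 0), (((i, k), σ), 1), (((omega0 M, y), 0), 0), ((((omega0 M).rev, Qm - y), 1), 0), ((((omega0 M).rev, Qm - x), 1), 1),
              (((omega0 M, x), 0), 1)] * Sg j t (i, k) σ -
          V6 j t ![(((omega0 M, k), σ), 0), (((omega0 M, k), σ), 1), (((omega0 M, y), 0), 0), ((((omega0 M).rev, Qm - y), 1), 0), ((((omega0 M).rev, Qm - x), 1), 1),
              (((omega0 M, x), 0), 1)] * Sg j t (omega0 M, k) σ‖ ≤ εS)
    (hTHS : (393216 / Real.pi * (64 * (klScale klE0 (n + 1) / klScale klE0 j) ^ 2 + (2 * (448 / 3 * Real.exp 2) + 8) + 64) * (2 * A₀S * (Real.pi * Real.sqrt 2 / (B.Dtmin - 4 * Af)))) ≤ 2 ^ 77 * (P.Klam * U) ^ 2)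
    (hZS : 64 / Real.pi * 8 * (Real.pi * Real.sqrt 2 / (B.Dtmin - 4 * Af) / (B.Dtmin - 4 * Af)) * ((∑ c, Lc c * (βc c - αc c)) / (2 * π)) +
      64 / Real.pi * 8 * (Real.pi * Real.sqrt 2 / (B.Dtmin - 4 * Af) * (2 * (2 * ‖c₀‖ + A₁) * (2 / (1 / 10))) / (B.Dtmin - 4 * Af) + 2 * (2 * ‖c₀‖ + A₁) * (1 / (B.Dtmin - 4 * Af) ^ 2 + Real.pi * Real.sqrt 2 * (2 + 4 * Af) / (B.Dtmin - 4 * Af) ^ 3)) ≤ 2 ^ 52 * (P.Klam * U) ^ 2)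
    (hTH : (393216 / Real.pi * (64 * (klScale klE0 (n + 1) / klScale klE0 j) ^ 2 + (2 * (448 / 3 * Real.exp 2) + 8) + 64) * (2 * (2 * ‖c₀‖ + A₁) * (Real.pi * Real.sqrt 2 / (B.Dtmin - 4 * Af)))) ≤ 2 ^ 76 * (P.Klam * U) ^ 2)
    (hTHR : (393216 / Real.pi * (64 * (klScale klE0 (n + 1) / klScale klE0 j) ^ 2 + (2 * (448 / 3 * Real.exp 2) + 8) + 64) * (2 * (2 * ‖c₀‖ + A₁) * (Real.pi * Real.sqrt 2 / (B.Dtmin - 4 * Af)))) +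
      2 * (64 / Real.pi * 8 * (2 * (2 * ‖c₀‖ + A₁) * (Real.pi * Real.sqrt 2 / (B.Dtmin - 4 * Af))) * (3 * (8 * (16 : ℝ) ^ (j - (n + 1))) + 512 * 1) +
      4 * (48 / Real.pi * 8 * (2 * (2 * ‖c₀‖ + A₁) * (Real.pi * Real.sqrt 2 / (B.Dtmin - 4 * Af))) * (3 * (8 * (16 : ℝ) ^ (j - (n + 1))) + 512 * 1))) ≤ 2 ^ 76 * (P.Klam * U) ^ 2)
    (hTR : (64 / Real.pi * 8 * (2 * (2 * ‖c₀‖ + A₁) * (Real.pi * Real.sqrt 2 / (B.Dtmin - 4 * Af))) * (3 * (8 * (16 : ℝ) ^ (j - (n + 1))) + 512 * 1) +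
      4 * (48 / Real.pi * 8 * (2 * (2 * ‖c₀‖ + A₁) * (Real.pi * Real.sqrt 2 / (B.Dtmin - 4 * Af))) * (3 * (8 * (16 : ℝ) ^ (j - (n + 1))) + 512 * 1))) * (4 + 8 / 3 * R.Gfr 1 * U ^ 2) ≤ 2 ^ 52 * (P.Klam * U) ^ 2)
    (Q : EngConsts) (hKlam : 0 ≤ P.Klam) (hCR : 0 ≤ Q.CR) {s : ℝ} (hs : 0 ≤ s)
    (hShareHd : (klScale klE0 n - klScale klE0 (n + 1)) * (2⁻¹ * RH) ≤ s * (klEngGeo11.cloc * (P.Klam * U) ^ 2 * (4 : ℝ) ^ (-(klEngGeo11.θ * n))))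
    (hShareRL : RL + 2 * (3 / π * (128 / Real.pi * 8 * (Real.pi * Real.sqrt 2 / (B.Dtmin - 4 * Af)) * ((∑ c, (2 * Lc c + 4 * Kg) * (Real.pi / L) * (βc c - αc c)) / (2 * π)))) ≤ s * (Q.CL β n / L))
    (hShareLat : (β ^ 2 + 1) * (2 ^ 18 * (Kg + LAS / 2) + 2 ^ 30 * ((2 * ‖c₀‖ + A₁) + A₀S / 2) * (4 + 8 / 3 * R.Gfr 1 * U ^ 2) * (16 : ℝ) ^ (j - (n + 1))) ≤ s * Q.CL β n)
    (hShareBorn : (524288 / Real.pi * (64 * (klScale klE0 (n + 1) / klScale klE0 j) ^ 2 + (2 * (448 / 3 * Real.exp 2) + 8) + 64) * (Real.pi * Real.sqrt 2 / (B.Dtmin - 4 * Af) * (2 * LAS + 2 * A₀S * (2 / (1 / 10))) / (B.Dtmin - 4 * Af) + 2 * A₀S * (1 / (B.Dtmin - 4 * Af) ^ 2 + Real.pi * Real.sqrt 2 * (2 + 4 * Af) / (B.Dtmin - 4 * Af) ^ 3))) * klE0 ≤ 4 * s * (Q.CR * (P.Klam * |U|) ^ 3))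
    (hShareEps : 2 * (ε₁ * (2048 * 15367) + ∑ w, A₂ w * (4096 * 15381) * (ρw w / π + ((L : ℝ))⁻¹)) + 2 * (εS * (2048 * 15367)) ≤ s * (klEngGeo11.cloc * (P.Klam * U) ^ 2 * (4 : ℝ) ^ (-(klEngGeo11.θ * n))) + s * (Q.CR * (P.Klam * |U|) ^ 3 * ((2 : ℝ) ^ n)⁻¹))
    (hj1 : j = n + 1) (hx : x ∈ klBall L μ 0) (hy : y ∈ klBall L μ 0)
    {Tb : TorusSite 2 L → TorusSite 2 L → TorusSite 2 L → ℝ}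
    (hraw : ∃ N : Matrix (TorusSite 2 L) (TorusSite 2 L) ℂ,
      (1 - diagonal (fun p => ((klTransferWeight L M β μ (klFlowFrameU L M β U μ n) n (softSymbolCompl L M β μ (klFlowFrameU L M β U μ n) n (n + 1)) Qm p -
          klTransferWeight L M β μ (klFlowFrameU L M β U μ n) n (softSymbolCompl L M β μ (klFlowFrameU L M β U μ n) n n) Qm p : ℝ) : ℂ)) *
          klMemberArrayF L M β U μ n (softSymbolCompl L M β μ (klFlowFrameU L M β U μ n) n n) Qm) * N = 1 ∧
      N * (1 - diagonal (fun p => ((klTransferWeight L M β μ (klFlowFrameU L M β U μ n) n (softSymbolCompl L M β μ (klFlowFrameU L M β U μ n) n (n + 1)) Qm p -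
          klTransferWeight L M β μ (klFlowFrameU L M β U μ n) n (softSymbolCompl L M β μ (klFlowFrameU L M β U μ n) n n) Qm p : ℝ) : ℂ)) *
          klMemberArrayF L M β U μ n (softSymbolCompl L M β μ (klFlowFrameU L M β U μ n) n n) Qm) = 1 ∧
      ∀ k ∈ klBall L μ 0, ∀ k' ∈ klBall L μ 0,
        ‖klMemberArrayF L M β U μ n (softSymbolCompl L M β μ (klFlowFrameU L M β U μ n) n (n + 1)) Qm k k' -
            (klMemberArrayF L M β U μ n (softSymbolCompl L M β μ (klFlowFrameU L M β U μ n) n n) Qm * N) k k'‖ ≤ Tb Qm k k')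
    {m' : ℝ} (hm' : 0 ≤ m') (hm'K : m' ^ 2 ≤ 2 ^ 8 * (P.Klam * U) ^ 2) (hA' : ∀ s t, ‖klPairArrayF L M β U μ n Qm s t‖ ≤ m')
    (hsm : m' * ∑ p, |klTransferWeight L M β μ (klFlowFrameU L M β U μ n) n (softSymbolCompl L M β μ (klFlowFrameU L M β U μ n) n (n + 1)) Qm p| ≤ 1 / 3)
    (hsoft : ∀ k, 0 ≤ softSymbolCompl L M β μ (klFlowFrameU L M β U μ n) n (n + 1) k ∧
      softSymbolCompl L M β μ (klFlowFrameU L M β U μ n) n (n + 1) k ≤ 1 - hubbardCutoffWeightCT L M β μ (klFlowFrameU L M β U μ n) (klScale klE0 n) k)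
    {E₂ Ebar : ℝ} (hTb : Tb Qm x y ≤ (2 : ℝ)⁻¹ ^ 15 * ((P.Klam * U) ^ 2 * (klEngGeo14.phGain (n + 1) (klTorusNorm L (x - y)) + klEngGeo14.phGain (n + 1) (klTorusNorm L (x + y - Qm)))) +
      E₂ + (2 : ℝ)⁻¹ ^ 5 * thermalBar klEngGeo14 P U β (n + 1))
    (hE : 2 * s * eremBar klEngGeo11 P Q U β L n + E₂ ≤ Ebar)
    (hshift : ‖klPairAmplitude L M β U μ (klFlowFrameU L M β U μ (n + 1)) (n + 1) Qm x y - klPairAmplitude L M β U μ (klFlowFrameU L M β U μ n) (n + 1) Qm x y‖ ≤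
      frameShiftBar P Q U (n + 1)) :
    ‖klPairAmplitude L M β U μ (klFlowFrameU L M β U μ (n + 1)) (n + 1) Qm x y - klPairAmplitude L M β U μ (klFlowFrameU L M β U μ n) n Qm x y‖ ≤
      gainBar klEngGeo14 P U (n + 1) (klTorusNorm L Qm) (klTorusNorm L (x - y)) (klTorusNorm L (x + y - Qm)) +
        Ebar + thermalBar klEngGeo14 P U β (n + 1) +
          legDressBarQ2 klEngGeo14 P Q U (n + 1) (legSliceCountT L β μ (klFlowFrameU L M β U μ (n + 1)) (n + 1) ![y, Qm - y, Qm - x, x]) +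
            frameShiftBar P Q U (n + 1) := by
  rw [softSymbolCompl_self] at hraw
  obtain ⟨Nr, hNr, -, hdef⟩ := hraw
  exact outClass_hout_klEngGeo14_of_shares_cells L M β U μ B hR hU hUu hμC hβ hβL hn hK hGL hGU hAb hA hA20 hμ hlo hhi hM A A' b' hAdef hA'def hb'def V hV V6 hV6 Sg hSg Hd hHd Φ hΦ Wd hWd Br hBr j hj hQ hZ hm0 hm hAm x y hM40 hM4 hM4K hM4KG hH hL c₀ F₁ F₂ F₁₀ hsplit Fx₁ Fx₂ Fx₁₀ hsplitX hA1 hKg hε1 hY0p₁ hY1p₁ hY0m₁ hY1m₁ hαβ hLc hr hserve hcover hcellp hcellm hflat₁ hY0B₁ hY1B₁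
    hY0A₁ hY1A₁ hcellB hcellA hflatX₁ cen cenx hρw hA2 hF₂ hsupp₂ hFx₂ hsuppx₂ hA0S hLAS hεS hY0S hY1S hflatS hTHS hZS hTH hTHR hTR Q hKlam hCR hs hShareHd hShareRL hShareLat hShareBorn hShareEps hj1 hx hy Tb Nr hNr hdef hm' hm'K hA' hsm hsoft hTb hE hshift

end Model

end Summit.HubbardSuperconductivity.HubbardSuperconductivity.Theorems.KLRegimeSplit

end
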